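import Summits.AnomalousDissipation.AnomalousDissipation.Theorems.MomentParityResolvedDissipationStubPathwiseFGT
import Summits.AnomalousDissipation.AnomalousDissipation.Theorems.MomentParityResolvedDissipationStubLowModePassage
import Summits.AnomalousDissipation.AnomalousDissipation.Theorems.MomentParityResolvedDissipationStubRestart
import Summits.AnomalousDissipation.AnomalousDissipation.Theorems.MomentParityResolvedDissipationTrajectoryUIOfGalerkinEE
import Literature.Analysis.FluidPDE.NSStokesTruncation2D
import HarnessLib

/-!
# TUI ⟹ GEE₀ᵃᵉ, part 1: no overshoot of the Galerkin dissipation integrals on a TUI window, and the energy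
# equality of the limit between strong times
# (crux `MomentParity.ResolvedDissipation`, stmt-AnomalousDissipation-14284; line `enstrophy-ui-transfer`, lead c7)

Supports stmt-AnomalousDissipation-14284 (helpers of the registered stub S14 `stub_galerkinEEaeOfTrajectoryUI`, which is
proved in `…StubGalerkinEEaeOfTrajectoryUI.lean`). Nothing here closes an item.

Leads c4/c6 recorded the conjecture-grade leaf TUI (S1 `stub_trajectoryUI`: `N`-uniform time-integrability of the
enstrophy along Galerkin orbits from `V`-bounded mean-zero data in the `L²`-ball over one window) as the strictly WEAKER
"no concentration in time" half of the energy equality for Galerkin limits (GEE), on the grounds that TUI does not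
exclude escape of enstrophy to high WAVENUMBERS at bounded enstrophy LEVELS in transients. It does: along every Galerkin
orbit the `N`-uniform PATHWISE Foias–Guillopé–Temam bound `∫ ‖ΔS_t a‖²/(1+‖∇S_t a‖²)² ≤ C` (`PathwiseFGT.stub_pathwiseFGT`,
S10) controls the palinstrophy on the good times `{‖∇u‖² ≤ M}`, hence (spectral Chebyshev) the enstrophy above any
cutoff `K` there; TUI controls the bad times; the low modes converge (`LowModePassage.stub_lowModePassage`, S11); members
restart as Galerkin orbits (`Restart.stub_restart`, S12). Consequently the dissipation integrals of a Hopf–Galerkin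
family do not overshoot on TUI windows after a bounded-enstrophy restart (`limsup_lintegral_le_of_trajectoryUI`), so with
Fatou they CONVERGE and the exact Galerkin energy identities pass to the limit (`energyEq_of_limsup_le`).

* `eLapNormSq_eq_eLaplacianNormSq`, `eGradNormSq_le_trunc_add_indicator_add` — spectral bookkeeping (tail split);
* `limsup_lintegral_le_of_trajectoryUI` — Lemma A (no overshoot on a TUI window);
* `energyEq_of_limsup_le` — Lemma B/C (no overshoot + Fatou ⟹ convergence ⟹ energy equality between strong times).

References: Foias–Guillopé–Temam 1981 (weighted `H²` bound); FMRT 2001 Ch. II App. A (A.55)–(A.60), Ch. IV (1.31);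
Robinson–Rodrigo–Sadowski 2016 Thm 4.4, Thm 4.6.
-/

noncomputable section

-- `Summit.<Summit>.<Problem>`: single-conjunct summit, the duplicate namespace segment is mandated.
set_option linter.dupNamespace false

namespace Summit.AnomalousDissipation.AnomalousDissipation.Theorems.MomentParityResolvedDissipation.GalerkinEEaeOfTUI

open MeasureTheory Filter Topology Set UnitAddTorus
open scoped ENNReal InnerProductSpace RealInnerProductSpace BigOperators
open Literature.Analysis.FunctionSpaces Literature.Analysis.FunctionSpaces.Torus
open Literature.Analysis.FluidPDE Literature.Analysis.FluidPDE.Torus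
open Summit.AnomalousDissipation.AnomalousDissipation.Theorems.CubicParityLoud.Negative (T3 R3)
open Summit.AnomalousDissipation.AnomalousDissipation.Theorems.MomentParity (lintegral_force_lt_top)
open Summit.AnomalousDissipation.AnomalousDissipation.Theorems.UniformResolution.Negative
  (eLapNormSq tailGradNormSq_mul_le_eLapNormSq eGradNormSq_eq_fourierTruncate_add_tail)

/-! ## Spectral bookkeeping: the enstrophy above the cutoff, split at an enstrophy level -/

/-- The two spectral Laplacian norms of the tree agree: `eLapNormSq v = eLaplacianNormSq v`
(`16π⁴ Σ |k|⁴ ‖v̂ k‖²` written with `ofReal(|k|²)²` resp. `ofReal(|k|⁴)`). [folklore] -/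
theorem eLapNormSq_eq_eLaplacianNormSq (v : T3 → R3) : eLapNormSq v = eLaplacianNormSq v := by
  rw [eLaplacianNormSq_eq_tsum']
  unfold eLapNormSq
  congr 1
  refine tsum_congr fun k => ?_
  rw [Real.rpow_two, ENNReal.ofReal_pow (freqNormSq_nonneg k)]

/-- The level-`M`, cutoff-`K` constant `c_{K,M} = (1+M)²/(4π²(K²+1))` of the tail split. -/
theorem tailConst_ne_top {M : ℝ≥0∞} (hM : M ≠ ⊤) (K : ℕ) :
    (1 + M) ^ 2 / ENNReal.ofReal (4 * Real.pi ^ 2 * ((K : ℝ) ^ 2 + 1)) ≠ ⊤ := by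
  refine ENNReal.div_ne_top (ENNReal.pow_ne_top (by simpa using hM)) ?_
  exact (ENNReal.ofReal_pos.2 (by positivity)).ne'

/-- `c_{K,M} → 0` as the cutoff `K → ∞` (finite level `M`). [folklore] -/
theorem tendsto_tailConst {M : ℝ≥0∞} (hM : M ≠ ⊤) :
    Tendsto (fun K : ℕ => (1 + M) ^ 2 / ENNReal.ofReal (4 * Real.pi ^ 2 * ((K : ℝ) ^ 2 + 1)))
      atTop (𝓝 0) := by
  have h1 : Tendsto (fun K : ℕ => 4 * Real.pi ^ 2 * ((K : ℝ) ^ 2 + 1)) atTop atTop := by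
    refine Tendsto.const_mul_atTop (by positivity) ?_
    refine tendsto_atTop_add_const_right _ _ ?_
    exact (tendsto_pow_atTop two_ne_zero).comp tendsto_natCast_atTop_atTop
  have h2 : Tendsto (fun K : ℕ => ENNReal.ofReal (4 * Real.pi ^ 2 * ((K : ℝ) ^ 2 + 1))) atTop (𝓝 ⊤) :=
    ENNReal.tendsto_ofReal_atTop.comp h1
  have h3 : Tendsto (fun K : ℕ => (ENNReal.ofReal (4 * Real.pi ^ 2 * ((K : ℝ) ^ 2 + 1)))⁻¹) atTop (𝓝 0) := by
    have := (tendsto_inv_iff (G := ℝ≥0∞)).2 h2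
    simpa using this
  have h4 := ENNReal.Tendsto.const_mul h3 (a := (1 + M) ^ 2) (Or.inr (ENNReal.pow_ne_top (by simpa using hM)))
  simpa [mul_zero, div_eq_mul_inv] using h4

/-- **Pointwise tail split.** For an integrable field `v`, a cutoff `K` and a finite level `M`:
`‖∇v‖² ≤ ‖∇P_K v‖² + ‖∇v‖²·1{‖∇v‖² > M} + c_{K,M} · ‖Δv‖²/(1+‖∇v‖²)²` — on `{‖∇v‖² ≤ M}` the tail above the
cutoff is `≤ ‖Δv‖²/(4π²(K²+1)) ≤ (1+M)²/(4π²(K²+1)) · ‖Δv‖²/(1+‖∇v‖²)²` (spectral Chebyshev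
`tailGradNormSq_mul_le_eLapNormSq`), on `{‖∇v‖² > M}` it is `≤ ‖∇v‖²`. [folklore] -/
theorem eGradNormSq_le_trunc_add_indicator_add (v : T3 → R3) (hv : Integrable v volume) (K : ℕ)
    {M : ℝ≥0∞} (hM : M ≠ ⊤) :
    eGradNormSq v ≤ eGradNormSq (fourierTruncate K v) + (Ioi M).indicator id (eGradNormSq v) +
      (1 + M) ^ 2 / ENNReal.ofReal (4 * Real.pi ^ 2 * ((K : ℝ) ^ 2 + 1)) *
        (eLaplacianNormSq v / (1 + eGradNormSq v) ^ 2) := by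
  by_cases hZ : M < eGradNormSq v
  · -- bad level: the indicator term is the whole enstrophy
    have : (Ioi M).indicator id (eGradNormSq v) = eGradNormSq v := indicator_of_mem (mem_Ioi.2 hZ) id
    rw [this]
    calc eGradNormSq v ≤ eGradNormSq (fourierTruncate K v) + eGradNormSq v := le_add_self
      _ ≤ _ := le_self_add
  · push Not at hZ
    -- good level: truncation + spectral Chebyshev on the tail
    have hsplit := eGradNormSq_eq_fourierTruncate_add_tail hv K
    set c : ℝ≥0∞ := ENNReal.ofReal (4 * Real.pi ^ 2 * ((K : ℝ) ^ 2 + 1)) with hc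
    have hcpos : c ≠ 0 := (ENNReal.ofReal_pos.2 (by positivity)).ne'
    have hctop : c ≠ ⊤ := ENNReal.ofReal_ne_top
    have htail : tailGradNormSq K v ≤ eLaplacianNormSq v / c := by
      rw [ENNReal.le_div_iff_mul_le (Or.inl hcpos) (Or.inl hctop), ← eLapNormSq_eq_eLaplacianNormSq]
      exact tailGradNormSq_mul_le_eLapNormSq K v
    -- `‖Δv‖² ≤ (1+M)² · ‖Δv‖²/(1+Z)²` on `{Z ≤ M}`
    have hZtop : eGradNormSq v ≠ ⊤ := ne_top_of_le_ne_top hM hZ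
    have hden0 : (1 + eGradNormSq v) ^ 2 ≠ 0 := pow_ne_zero _ (by simp)
    have hdentop : (1 + eGradNormSq v) ^ 2 ≠ ⊤ := ENNReal.pow_ne_top (by simpa using hZtop)
    have hlap : eLaplacianNormSq v ≤ (1 + M) ^ 2 * (eLaplacianNormSq v / (1 + eGradNormSq v) ^ 2) := by
      calc eLaplacianNormSq v = (1 + eGradNormSq v) ^ 2 * (eLaplacianNormSq v / (1 + eGradNormSq v) ^ 2) := by
            rw [ENNReal.mul_div_cancel hden0 hdentop]
        _ ≤ (1 + M) ^ 2 * (eLaplacianNormSq v / (1 + eGradNormSq v) ^ 2) := by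
            gcongr
    calc eGradNormSq v = eGradNormSq (fourierTruncate K v) + tailGradNormSq K v := hsplit
      _ ≤ eGradNormSq (fourierTruncate K v) + eLaplacianNormSq v / c := by gcongr
      _ ≤ eGradNormSq (fourierTruncate K v) +
            (1 + M) ^ 2 * (eLaplacianNormSq v / (1 + eGradNormSq v) ^ 2) / c := by
          gcongr
      _ = eGradNormSq (fourierTruncate K v) + 0 +
            (1 + M) ^ 2 / c * (eLaplacianNormSq v / (1 + eGradNormSq v) ^ 2) := by
          rw [add_zero, ENNReal.mul_div_right_comm]
      _ ≤ _ := by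
          gcongr
          exact zero_le


/-! ## Measurability of the truncated enstrophy in time -/

/-- The truncated enstrophy `τ ↦ ‖∇P_K (U τ)‖²` is a.e.-measurable in time as soon as the Fourier
coefficients are: it is `ofReal` of a finite band sum (`LowModePassage.eGradNormSq_fourierTruncate_band`).
[folklore] -/
theorem aemeasurable_eGradNormSq_fourierTruncate (K : ℕ) {U : ℝ → T3 → R3} {μ : Measure ℝ}
    (hmeas : ∀ k, AEStronglyMeasurable (fun τ => mFourierCoeff (EuclideanSpace.complexify ∘ U τ) k) μ) :
    AEMeasurable (fun τ => eGradNormSq (fourierTruncate K (U τ))) μ := by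
  simp only [LowModePassage.eGradNormSq_fourierTruncate_band]
  have h : AEMeasurable (fun τ => 4 * Real.pi ^ 2 * ∑ k ∈ freqBall K,
      freqNormSq k * ‖mFourierCoeff (EuclideanSpace.complexify ∘ U τ) k‖ ^ 2) μ := by
    refine AEMeasurable.const_mul (Finset.aemeasurable_fun_sum (freqBall K) fun k _ => ?_) _
    exact ((hmeas k).norm.aemeasurable.pow_const 2).const_mul _
  exact ENNReal.measurable_ofReal.comp_aemeasurable h

/-! ## Lemma A — the limsup bound on a TUI window after a bounded-enstrophy restart -/

/-- **The dissipation integrals do not overshoot on a TUI window (lead c7).** Let `U` be a Hopf–Galerkin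
family of NS(ν, f) (exact steady smooth mean-zero force, mean-zero data) converging coefficientwise to `u`,
with slices in the `L²`-ball of radius `R'` up to time `Tb`; assume TUI at radius `R'` with window `T₀`, and let
`p ≥ 0` be a restart time at which the enstrophies are bounded, `‖∇U n p‖² ≤ G < ∞`. Then for every
`q ∈ [p, p + T₀]`, `q ≤ Tb`: `limsup_n ∫_p^q ‖∇U n‖² ≤ ∫_p^q ‖∇u‖²`.
Proof: split `‖∇U n τ‖² ≤ ‖∇P_K U n τ‖² + Z·1{Z > M} + c_{K,M}‖ΔU n τ‖²/(1+Z)²`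
(`eGradNormSq_le_trunc_add_indicator_add`); the members restart as Galerkin orbits of the mean-zero modes
`U n p` (`Restart.stub_restart`), so TUI bounds the second integral by `ε` and the pathwise FGT bound
(`PathwiseFGT.stub_pathwiseFGT`) the third by `c_{K,M} C`, uniformly in `n`; the first converges to
`∫‖∇P_K u‖² ≤ ∫‖∇u‖²` (`LowModePassage.stub_lowModePassage`, `eGradNormSq_fourierTruncate_le`); let `K → ∞`
(`c_{K,M} → 0`), then `ε → 0`. -/
theorem limsup_lintegral_le_of_trajectoryUI {ν : ℝ} (hν : 0 < ν) {f : T3 → R3} (hf : IsSmooth f)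
    (hf0 : HasZeroMean f) {u₀ : T3 → R3} {N : ℕ → ℕ} {U : ℕ → ℝ → T3 → R3} {u : ℝ → T3 → R3}
    (hF : IsHopfGalerkinFamily ν (fun _ => f) u₀ N (fun _ _ => f) U) (hmean : ∀ n, HasZeroMean (U n 0))
    (hu : ∀ t, 0 ≤ t → MemLp (u t) 2 volume)
    (hcv : ∀ t, 0 ≤ t → ∀ k, Tendsto (fun n => mFourierCoeff (EuclideanSpace.complexify ∘ U n t) k) atTop
      (𝓝 (mFourierCoeff (EuclideanSpace.complexify ∘ u t) k)))
    {Tb R' : ℝ} (hR' : ∀ n t, 0 ≤ t → t ≤ Tb → ∫ x, ‖U n t x‖ ^ 2 ≤ R' ^ 2) {T₀ : ℝ} (hT₀ : 0 < T₀)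
    (hTUI : ∀ G : ℝ≥0∞, G ≠ ⊤ → ∀ ε : ℝ≥0∞, 0 < ε → ∃ M : ℝ≥0∞, M ≠ ⊤ ∧
      ∀ (N : ℕ) (a : T3 → R3), IsGalerkinMode N a → HasZeroMean a → ∫ x, ‖a x‖ ^ 2 ≤ R' ^ 2 →
        eGradNormSq a ≤ G →
        ∫⁻ t in Ioo 0 T₀, (Ioi M).indicator id (eGradNormSq (galerkinFlow ν f N t a)) ≤ ε)
    {p : ℝ} (hp : 0 ≤ p) {G : ℝ≥0∞} (hG : G ≠ ⊤) (hZp : ∀ n, eGradNormSq (U n p) ≤ G)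
    {q : ℝ} (hpq : p ≤ q) (hqT₀ : q ≤ p + T₀) (hqTb : q ≤ Tb) :
    limsup (fun n => ∫⁻ τ in Ioo p q, eGradNormSq (U n τ)) atTop ≤ ∫⁻ τ in Ioo p q, eGradNormSq (u τ) := by
  -- the pathwise FGT constant at radius `R'` on the window `T₀`
  obtain ⟨C, hC, hFGT⟩ := PathwiseFGT.stub_pathwiseFGT ν hν f hf hf0 R' T₀ hT₀.le
  set L : ℝ≥0∞ := ∫⁻ τ in Ioo p q, eGradNormSq (u τ) with hL
  -- restart data at time `p`
  have hrs := fun n => Restart.stub_restart ν hν f hf hf0 u₀ N U hF hmean n p hp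
  -- the low modes converge on `(p, q)`
  have hlow : ∀ K : ℕ, Tendsto (fun n => ∫⁻ τ in Ioo p q, eGradNormSq (fourierTruncate K (U n τ))) atTop
      (𝓝 (∫⁻ τ in Ioo p q, eGradNormSq (fourierTruncate K (u τ)))) := by
    intro K
    refine LowModePassage.stub_lowModePassage K U u p q hp hpq (R' ^ 2)
      (fun n τ hτ _ => hF.memLp_slice n (hp.trans hτ)) (fun n τ hτ hτq => hR' n τ (hp.trans hτ) (hτq.trans hqTb))
      (fun n k => (hF.aestronglyMeasurable_mFourierCoeff n k).mono_measure
        (Measure.restrict_mono (fun τ hτ => mem_Ioi.2 (hp.trans_lt hτ.1)) le_rfl))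
      (fun τ hτ _ k => hcv τ (hp.trans hτ) k)
  have hlowle : ∀ K : ℕ, ∫⁻ τ in Ioo p q, eGradNormSq (fourierTruncate K (u τ)) ≤ L := fun K =>
    setLIntegral_mono' measurableSet_Ioo fun τ hτ =>
      eGradNormSq_fourierTruncate_le ((hu τ (hp.trans hτ.1.le)).integrable one_le_two) K
  -- MAIN ESTIMATE: for every tolerance `ε > 0` and cutoff `K`, `limsup ≤ L + ε + c_{K,M(ε)} C`
  have hmain : ∀ ε : ℝ≥0∞, 0 < ε → ∃ M : ℝ≥0∞, M ≠ ⊤ ∧ ∀ K : ℕ,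
      limsup (fun n => ∫⁻ τ in Ioo p q, eGradNormSq (U n τ)) atTop ≤
        L + ε + (1 + M) ^ 2 / ENNReal.ofReal (4 * Real.pi ^ 2 * ((K : ℝ) ^ 2 + 1)) * C := by
    intro ε hε
    obtain ⟨M, hM, hMε⟩ := hTUI G hG ε hε
    refine ⟨M, hM, fun K => ?_⟩
    set cK : ℝ≥0∞ := (1 + M) ^ 2 / ENNReal.ofReal (4 * Real.pi ^ 2 * ((K : ℝ) ^ 2 + 1)) with hcK
    have hcKtop : cK ≠ ⊤ := tailConst_ne_top hM K
    -- pointwise-in-`n` bound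
    have hn : ∀ n, ∫⁻ τ in Ioo p q, eGradNormSq (U n τ) ≤
        (∫⁻ τ in Ioo p q, eGradNormSq (fourierTruncate K (U n τ))) + ε + cK * C := by
      intro n
      obtain ⟨hmode, hmean', -, hshift⟩ := hrs n
      -- split the integrand
      have hsplit : ∫⁻ τ in Ioo p q, eGradNormSq (U n τ) ≤
          ∫⁻ τ in Ioo p q, (eGradNormSq (fourierTruncate K (U n τ)) +
            (Ioi M).indicator id (eGradNormSq (U n τ)) +
            cK * (eLaplacianNormSq (U n τ) / (1 + eGradNormSq (U n τ)) ^ 2)) :=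
        setLIntegral_mono' measurableSet_Ioo fun τ hτ =>
          eGradNormSq_le_trunc_add_indicator_add (U n τ)
            ((hF.memLp_slice n (hp.trans hτ.1.le)).integrable one_le_two) K hM
      -- measurability of the first two summands on `(p, q)`
      have hsub : Ioo p q ⊆ Ioi 0 := fun τ hτ => mem_Ioi.2 (hp.trans_lt hτ.1)
      have hm1 : AEMeasurable (fun τ => eGradNormSq (fourierTruncate K (U n τ))) (volume.restrict (Ioo p q)) :=
        aemeasurable_eGradNormSq_fourierTruncate K fun k =>
          (hF.aestronglyMeasurable_mFourierCoeff n k).mono_measure (Measure.restrict_mono hsub le_rfl)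
      have hm2 : AEMeasurable (fun τ => (Ioi M).indicator id (eGradNormSq (U n τ))) (volume.restrict (Ioo p q)) := by
        have hZm : AEMeasurable (fun τ => eGradNormSq (U n τ)) (volume.restrict (Ioo p q)) :=
          (hF.aemeasurable_eGradNormSq n q).mono_measure (Measure.restrict_mono (Ioo_subset_Ioo_left hp) le_rfl)
        exact ((measurable_id.indicator measurableSet_Ioi).comp_aemeasurable hZm)
      have hm12 : AEMeasurable (fun τ => eGradNormSq (fourierTruncate K (U n τ)) +
          (Ioi M).indicator id (eGradNormSq (U n τ))) (volume.restrict (Ioo p q)) := hm1.add hm2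
      rw [lintegral_add_left' hm12, lintegral_add_left' hm1, lintegral_const_mul' _ _ hcKtop] at hsplit
      -- the TUI term: shift to the orbit of `U n p` on `(0, T₀)`
      have hwin : Ioo p q ⊆ Ioo p (p + T₀) := Ioo_subset_Ioo_right hqT₀
      have hTUIn : ∫⁻ τ in Ioo p q, (Ioi M).indicator id (eGradNormSq (U n τ)) ≤ ε := by
        refine (lintegral_mono_set hwin).trans ?_
        rw [hshift T₀ (fun v => (Ioi M).indicator id (eGradNormSq v))]
        exact hMε (N n) (U n p) hmode hmean' (hR' n p hp (hpq.trans hqTb)) (hZp n)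
      -- the FGT term
      have hFGTn : ∫⁻ τ in Ioo p q, eLaplacianNormSq (U n τ) / (1 + eGradNormSq (U n τ)) ^ 2 ≤ C := by
        refine (lintegral_mono_set hwin).trans ?_
        rw [hshift T₀ (fun v => eLaplacianNormSq v / (1 + eGradNormSq v) ^ 2)]
        exact hFGT (N n) (U n p) hmode hmean' (hR' n p hp (hpq.trans hqTb))
      calc ∫⁻ τ in Ioo p q, eGradNormSq (U n τ)
          ≤ (∫⁻ τ in Ioo p q, eGradNormSq (fourierTruncate K (U n τ))) +
              (∫⁻ τ in Ioo p q, (Ioi M).indicator id (eGradNormSq (U n τ))) +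
              cK * ∫⁻ τ in Ioo p q, eLaplacianNormSq (U n τ) / (1 + eGradNormSq (U n τ)) ^ 2 := hsplit
        _ ≤ (∫⁻ τ in Ioo p q, eGradNormSq (fourierTruncate K (U n τ))) + ε + cK * C := by
            gcongr
    -- pass to the limsup
    have hlim : Tendsto (fun n => (∫⁻ τ in Ioo p q, eGradNormSq (fourierTruncate K (U n τ))) + ε + cK * C)
        atTop (𝓝 ((∫⁻ τ in Ioo p q, eGradNormSq (fourierTruncate K (u τ))) + ε + cK * C)) :=
      ((hlow K).add_const ε).add_const (cK * C)
    calc limsup (fun n => ∫⁻ τ in Ioo p q, eGradNormSq (U n τ)) atTop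
        ≤ limsup (fun n => (∫⁻ τ in Ioo p q, eGradNormSq (fourierTruncate K (U n τ))) + ε + cK * C) atTop :=
          limsup_le_limsup (Eventually.of_forall hn)
      _ = (∫⁻ τ in Ioo p q, eGradNormSq (fourierTruncate K (u τ))) + ε + cK * C := hlim.limsup_eq
      _ ≤ L + ε + cK * C := by gcongr; exact hlowle K
  -- let `K → ∞`, then `ε → 0`
  refine ENNReal.le_of_forall_pos_le_add fun ε hε _ => ?_
  obtain ⟨M, hM, hK⟩ := hmain ε (by exact_mod_cast hε)
  have hlimK : Tendsto (fun K : ℕ => L + ε + (1 + M) ^ 2 / ENNReal.ofReal (4 * Real.pi ^ 2 * ((K : ℝ) ^ 2 + 1)) * C)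
      atTop (𝓝 (L + ε + 0 * C)) :=
    Tendsto.const_add _ (ENNReal.Tendsto.mul_const (tendsto_tailConst hM) (Or.inr hC))
  rw [zero_mul, add_zero] at hlimK
  exact ge_of_tendsto' hlimK hK


/-! ## Lemma B/C — no overshoot + Fatou ⟹ the dissipation integrals converge ⟹ energy equality of the limit -/

/-- **Energy equality of the limit between two strong times from the limsup bound (lead c7).** Along a
Hopf–Galerkin family of NS(ν, f) (exact steady smooth force) converging coefficientwise to `u`, let
`0 ≤ p ≤ q` be two times of STRONG `L²` convergence with `limsup_n ∫_p^q ‖∇U n‖² ≤ ∫_p^q ‖∇u‖²`. Then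
`∫_p^q ‖∇U n‖² → ∫_p^q ‖∇u‖²` (Fatou from below, `eGradNormSq_le_liminf_of_tendsto_mFourierCoeff`), and the exact
energy identities `IsHopfGalerkinFamily.energy_eq` pass to the limit (energies by
`tendsto_kineticEnergy_of_tendsto_eLpNorm`, work by `IsHopfGalerkinFamily.tendsto_work`): the limit satisfies the
energy EQUALITY on `[p, q]`. [folklore; RobinsonRodrigoSadowski2016 Thm 4.6 (proof)] -/
theorem energyEq_of_limsup_le {ν : ℝ} (hν : 0 < ν) {f : T3 → R3} (hf : IsSmooth f)
    {u₀ : T3 → R3} (hu₀ : MemLp u₀ 2 volume) {N : ℕ → ℕ} {U : ℕ → ℝ → T3 → R3} {u : ℝ → T3 → R3}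
    (hF : IsHopfGalerkinFamily ν (fun _ => f) u₀ N (fun _ _ => f) U)
    (hum : AEStronglyMeasurable (stLift u) (volume.restrict (Ioi (0 : ℝ) ×ˢ univ)))
    (hu : ∀ t, 0 ≤ t → MemLp (u t) 2 volume)
    (hcv : ∀ t, 0 ≤ t → ∀ k, Tendsto (fun n => mFourierCoeff (EuclideanSpace.complexify ∘ U n t) k) atTop
      (𝓝 (mFourierCoeff (EuclideanSpace.complexify ∘ u t) k)))
    {p q : ℝ} (hp : 0 ≤ p) (hpq : p ≤ q)
    (hsp : Tendsto (fun n => eLpNorm (U n p - u p) 2 volume) atTop (𝓝 0))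
    (hsq : Tendsto (fun n => eLpNorm (U n q - u q) 2 volume) atTop (𝓝 0))
    (hsup : limsup (fun n => ∫⁻ τ in Ioo p q, eGradNormSq (U n τ)) atTop ≤ ∫⁻ τ in Ioo p q, eGradNormSq (u τ)) :
    kineticEnergy (u q) + ν * (∫⁻ τ in Ioo p q, eGradNormSq (u τ)).toReal =
      kineticEnergy (u p) + ∫ τ in p..q, ∫ x, ⟪f x, u τ x⟫_ℝ := by
  have hfm := Literature.Analysis.FluidPDE.aestronglyMeasurable_stLift_const hf
    (volume.restrict (Ioi (0 : ℝ) ×ˢ univ))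
  have hf₂ : ∀ T : ℝ, 0 < T → ∫⁻ _ in Ioo (0 : ℝ) T, ∫⁻ x, ‖f x‖ₑ ^ 2 < ⊤ := fun T _ =>
    lintegral_force_lt_top hf T
  set L : ℝ≥0∞ := ∫⁻ τ in Ioo p q, eGradNormSq (u τ) with hL
  -- Fatou from below: `L ≤ liminf`
  have hinf : L ≤ liminf (fun n => ∫⁻ τ in Ioo p q, eGradNormSq (U n τ)) atTop := by
    have hmeas : ∀ n, AEMeasurable (fun τ => eGradNormSq (U n τ)) (volume.restrict (Ioo p q)) := fun n =>
      (hF.aemeasurable_eGradNormSq n q).mono_measure (Measure.restrict_mono (Ioo_subset_Ioo_left hp) le_rfl)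
    calc L ≤ ∫⁻ τ in Ioo p q, liminf (fun n => eGradNormSq (U n τ)) atTop :=
          setLIntegral_mono' measurableSet_Ioo fun τ hτ =>
            eGradNormSq_le_liminf_of_tendsto_mFourierCoeff hcv (hp.trans hτ.1.le)
      _ ≤ liminf (fun n => ∫⁻ τ in Ioo p q, eGradNormSq (U n τ)) atTop := lintegral_liminf_le' hmeas
  have hD : Tendsto (fun n => ∫⁻ τ in Ioo p q, eGradNormSq (U n τ)) atTop (𝓝 L) :=
    tendsto_of_le_liminf_of_limsup_le hinf hsup
  -- finiteness of the limit dissipation, `toReal` convergence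
  have hLtop : L < ⊤ :=
    (lintegral_mono_set (Ioo_subset_Ioo hp (by linarith : q ≤ q + 1))).trans_lt
      (hF.lintegral_eGradNormSq_limit_lt_top hν hu₀ hfm hf₂ hcv (T := q + 1) (by linarith))
  have hDr : Tendsto (fun n => (∫⁻ τ in Ioo p q, eGradNormSq (U n τ)).toReal) atTop (𝓝 L.toReal) :=
    (ENNReal.tendsto_toReal hLtop.ne).comp hD
  -- energies at the two strong times and the work
  have hEp : Tendsto (fun n => kineticEnergy (U n p)) atTop (𝓝 (kineticEnergy (u p))) :=
    tendsto_kineticEnergy_of_tendsto_eLpNorm (Eventually.of_forall fun n => hF.memLp_slice n hp) (hu p hp) hsp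
  have hEq : Tendsto (fun n => kineticEnergy (U n q)) atTop (𝓝 (kineticEnergy (u q))) :=
    tendsto_kineticEnergy_of_tendsto_eLpNorm (Eventually.of_forall fun n => hF.memLp_slice n (hp.trans hpq))
      (hu q (hp.trans hpq)) hsq
  have hW : Tendsto (fun n => ∫ τ in p..q, ∫ x, ⟪f x, U n τ x⟫_ℝ) atTop
      (𝓝 (∫ τ in p..q, ∫ x, ⟪f x, u τ x⟫_ℝ)) :=
    hF.tendsto_work hν hu₀ hfm hf₂ hum hu hcv (T := q + 1) (by linarith) hp hpq (by linarith)
  -- pass the exact identities to the limit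
  have hlhs : Tendsto (fun n => kineticEnergy (U n q) + ν * (∫⁻ τ in Ioo p q, eGradNormSq (U n τ)).toReal) atTop
      (𝓝 (kineticEnergy (u q) + ν * L.toReal)) := hEq.add (hDr.const_mul ν)
  have hrhs : Tendsto (fun n => kineticEnergy (U n p) + ∫ τ in p..q, ∫ x, ⟪f x, U n τ x⟫_ℝ) atTop
      (𝓝 (kineticEnergy (u p) + ∫ τ in p..q, ∫ x, ⟪f x, u τ x⟫_ℝ)) := hEp.add hW
  have heq : (fun n => kineticEnergy (U n q) + ν * (∫⁻ τ in Ioo p q, eGradNormSq (U n τ)).toReal) =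
      fun n => kineticEnergy (U n p) + ∫ τ in p..q, ∫ x, ⟪f x, U n τ x⟫_ℝ :=
    funext fun n => hF.energy_eq n p q hp hpq
  rw [heq] at hlhs
  exact tendsto_nhds_unique hlhs hrhs


end Summit.AnomalousDissipation.AnomalousDissipation.Theorems.MomentParityResolvedDissipation.GalerkinEEaeOfTUI

end
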